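import Mathlib
import Summits.PneNP.PneNP.Theorems.OverlapGapAlgebraSolvableImpliesStableSectionMeanSquareFromMeanFilter
import Summits.PneNP.PneNP.Theorems.OverlapGapAlgebraSolvableImpliesStableSectionUnitClauseObjects
import Summits.PneNP.PneNP.Theorems.OverlapGapAlgebraSolvableImpliesStableSectionUnitClauseLocal
import Summits.PneNP.PneNP.Theorems.OverlapGapAlgebraSolvableImpliesStableSectionUnitClauseMean
import Summits.PneNP.PneNP.Theorems.OverlapGapAlgebraSolvableImpliesStableSectionUnitClauseRates
import Summits.PneNP.PneNP.Theorems.OverlapGapAlgebraSolvableImpliesStableSectionSplit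

/-!
# PneNP / OverlapGapAlgebra — crux `SolvableImpliesStableSection` (stmt-PneNP-2463):
# the UNIT CLAUSE block (16/16) — assembly: child G (`stub_lowDensity`) and the unit-clause threshold

Support for crux `stmt-PneNP-2463` (`Summit.PneNP.PneNP.Theses.OverlapGapAlgebra.SolvableImpliesStableSection`).
THE RESULT OF THE BLOCK.  For every `k ≥ 3`, every density `α` below the Chao–Franco unit-clause
threshold — `α·(k²-k)·2M_k < 2^k`, `M_k = (k-2)^{k-2}/(k-1)^{k-1}`, i.e. `α < (2^{k-1}/k)((k-1)/(k-2))^{k-2}`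
— and ALL `η, ν, c > 0`, the conclusion of the crux holds outright for all large `n`: the section is
`R` rounds of the LOCALIZED UNIT-CLAUSE RULE (`…UnitClauseObjects`), a radius-`R` local rule
(`sissU_local`), whose mean violation is `O_{k,α}(m/R + 1)` (`sissU_sum_violated_le`, from the
deferred-decision first and second moments `sissU_sum_unit_le` / `sissU_sum_unit_sq_le`, the
contradiction pairs, the collisions and the degenerate clauses), so that the mean-square engine from a
mean bound (`sissMV_concl_of_localMean`) applies with `R = R(k, α, ν)` from `sissU_rates`.

* `sissU_terms_le` — the three terms of the mean bound against the rate shape `R·Q·D₁/n + D₀`;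
* `sissU_conclusion_of_threshold` — the conclusion of the crux below the unit-clause threshold;
* `sissU_lowDensity` — child G of line `RegimeSplit` VERBATIM (`α < 2^k/k`, every `k ≥ 3`, all `η, ν`),
  also under the stub's registered name `stub_lowDensity`;
* `sissU_solvableImpliesStableSection_of_mid_core` — the crux from children M and T alone.
No new definitions; axioms `propext`, `Classical.choice`, `Quot.sound`.
-/

set_option linter.dupNamespace false -- `Summit.PneNP.PneNP.…`: summit = sub-problem (D-0017)

namespace Summit.PneNP.PneNP.Theorems

open Finset Filter
open scoped Classical

section Assembly

/-- The number of clause contents: `#(Fin k → Fin n × Bool) = (2n)^k`. -/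
theorem sissU_card_contents (k n : ℕ) : Fintype.card (Fin k → Fin n × Bool) = (2 * n) ^ k := by
  rw [Fintype.card_fun, Fintype.card_prod, Fintype.card_fin, Fintype.card_bool, Fintype.card_fin, mul_comm]

/-- **The three terms of the mean bound.** With `K = K'·n^{k-1}`, `K₂ = K₂'·n^{k-2}`, `#C = (2n)^k` and
`m ≤ αn`, the three terms of `sissU_sum_violated_le` are at most `R·Q·(α²K'K₂'/(2^k)²)/n`,
`R·Q·α(k²-k)/n` and `α(k²-k)`. -/
theorem sissU_terms_le (k : ℕ) (hk : 3 ≤ k) (n m R : ℕ) (hn : 1 ≤ n) (α K' K₂' Q : ℝ) (hα : 0 ≤ α)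
    (hK' : 0 ≤ K') (hK₂' : 0 ≤ K₂') (hQ : 0 ≤ Q) (hm : (m : ℝ) ≤ α * n) :
    (R : ℝ) * (((m : ℝ) * m) * ((K' * (n : ℝ) ^ (k - 1)) * (K₂' * (n : ℝ) ^ (k - 2))) * Q) /
        ((2 * (n : ℝ)) ^ k) ^ 2 +
      (R : ℝ) * ((m : ℝ) * (((k * k - k : ℕ) : ℝ) * (4 * (2 * (n : ℝ)) ^ (k - 2))) * Q) / (2 * (n : ℝ)) ^ k +
      (m : ℝ) * (((k * k - k : ℕ) : ℝ) * (2 * (2 * n) ^ (k - 1) : ℕ)) / (2 * (n : ℝ)) ^ k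
    ≤ (R : ℝ) * Q * (α ^ 2 * (K' * K₂' / ((2 : ℝ) ^ k) ^ 2) + α * ((k * k - k : ℕ) : ℝ)) / n +
      α * ((k * k - k : ℕ) : ℝ) := by
  have hnpos : (0 : ℝ) < n := by exact_mod_cast hn
  have hk1 : 1 ≤ k := le_trans (by norm_num) hk
  have hk2 : 2 ≤ k := le_trans (by norm_num) hk
  have hm0 : (0 : ℝ) ≤ m := Nat.cast_nonneg m
  -- powers
  have hnk1 : (n : ℝ) ^ k = (n : ℝ) ^ (k - 1) * n := by
    rw [← pow_succ, Nat.sub_add_cancel hk1]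
  have hnk2 : (n : ℝ) ^ (k - 1) = (n : ℝ) ^ (k - 2) * n := by
    rw [← pow_succ]; congr 1; omega
  have h2k : (2 : ℝ) ^ k = (2 : ℝ) ^ (k - 2) * 4 := by
    rw [show (4 : ℝ) = 2 ^ 2 by norm_num, ← pow_add]; congr 1; omega
  have h2k1 : (2 : ℝ) ^ k = (2 : ℝ) ^ (k - 1) * 2 := by
    rw [← pow_succ, Nat.sub_add_cancel hk1]
  set p : ℝ := (n : ℝ) ^ (k - 2) with hp
  have hp0 : 0 < p := by positivity
  have hCpos : (0 : ℝ) < (2 * (n : ℝ)) ^ k := by positivity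
  have hmm : (m : ℝ) * m ≤ (α * n) * (α * n) := mul_le_mul hm hm hm0 (by positivity)
  -- term 1
  have hT1 : (R : ℝ) * (((m : ℝ) * m) * ((K' * (n : ℝ) ^ (k - 1)) * (K₂' * (n : ℝ) ^ (k - 2))) * Q) /
      ((2 * (n : ℝ)) ^ k) ^ 2 ≤ (R : ℝ) * Q * (α ^ 2 * (K' * K₂' / ((2 : ℝ) ^ k) ^ 2)) / n := by
    rw [div_le_div_iff₀ (by positivity) hnpos]
    have e1 : (R : ℝ) * Q * (α ^ 2 * (K' * K₂' / ((2 : ℝ) ^ k) ^ 2)) * ((2 * (n : ℝ)) ^ k) ^ 2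
        = (R : ℝ) * (((α * n) * (α * n)) * ((K' * (n : ℝ) ^ (k - 1)) * (K₂' * (n : ℝ) ^ (k - 2))) * Q) * n := by
      rw [mul_pow, hnk1, hnk2]
      field_simp
      ring
    rw [e1]
    have hrest : 0 ≤ (K' * (n : ℝ) ^ (k - 1)) * (K₂' * (n : ℝ) ^ (k - 2)) := by positivity
    have h1 : (R : ℝ) * (((m : ℝ) * m) * ((K' * (n : ℝ) ^ (k - 1)) * (K₂' * (n : ℝ) ^ (k - 2))) * Q)
        ≤ (R : ℝ) * (((α * n) * (α * n)) * ((K' * (n : ℝ) ^ (k - 1)) * (K₂' * (n : ℝ) ^ (k - 2))) * Q) :=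
      mul_le_mul_of_nonneg_left (mul_le_mul_of_nonneg_right (mul_le_mul_of_nonneg_right hmm hrest) hQ)
        (Nat.cast_nonneg R)
    exact mul_le_mul_of_nonneg_right h1 hnpos.le
  -- term 2
  have hT2 : (R : ℝ) * ((m : ℝ) * (((k * k - k : ℕ) : ℝ) * (4 * (2 * (n : ℝ)) ^ (k - 2))) * Q) / (2 * (n : ℝ)) ^ k
      ≤ (R : ℝ) * Q * (α * ((k * k - k : ℕ) : ℝ)) / n := by
    rw [div_le_div_iff₀ hCpos hnpos]
    have e2 : (R : ℝ) * Q * (α * ((k * k - k : ℕ) : ℝ)) * (2 * (n : ℝ)) ^ k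
        = (R : ℝ) * ((α * n) * (((k * k - k : ℕ) : ℝ) * (4 * (2 * (n : ℝ)) ^ (k - 2))) * Q) * n := by
      rw [mul_pow, mul_pow, h2k, hnk1, hnk2]; ring
    rw [e2]
    have hrest : 0 ≤ ((k * k - k : ℕ) : ℝ) * (4 * (2 * (n : ℝ)) ^ (k - 2)) := by positivity
    exact mul_le_mul_of_nonneg_right (mul_le_mul_of_nonneg_left
      (mul_le_mul_of_nonneg_right (mul_le_mul_of_nonneg_right hm hrest) hQ) (Nat.cast_nonneg R)) hnpos.le
  -- term 3
  have hT3 : (m : ℝ) * (((k * k - k : ℕ) : ℝ) * (2 * (2 * n) ^ (k - 1) : ℕ)) / (2 * (n : ℝ)) ^ k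
      ≤ α * ((k * k - k : ℕ) : ℝ) := by
    rw [div_le_iff₀ hCpos]
    have e3 : α * ((k * k - k : ℕ) : ℝ) * (2 * (n : ℝ)) ^ k
        = (α * n) * (((k * k - k : ℕ) : ℝ) * (2 * (2 * (n : ℝ)) ^ (k - 1))) := by
      rw [mul_pow, mul_pow, h2k1, hnk1]; ring
    rw [e3]
    push_cast
    exact mul_le_mul_of_nonneg_right hm (by positivity)
  have hsum : (R : ℝ) * Q * (α ^ 2 * (K' * K₂' / ((2 : ℝ) ^ k) ^ 2)) / n + (R : ℝ) * Q * (α * ((k * k - k : ℕ) : ℝ)) / n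
      = (R : ℝ) * Q * (α ^ 2 * (K' * K₂' / ((2 : ℝ) ^ k) ^ 2) + α * ((k * k - k : ℕ) : ℝ)) / n := by
    rw [← add_div]; ring
  calc _ ≤ (R : ℝ) * Q * (α ^ 2 * (K' * K₂' / ((2 : ℝ) ^ k) ^ 2)) / n + (R : ℝ) * Q * (α * ((k * k - k : ℕ) : ℝ)) / n +
        α * ((k * k - k : ℕ) : ℝ) := add_le_add (add_le_add hT1 hT2) hT3
    _ = _ := by rw [hsum]

/-- **The conclusion of `SolvableImpliesStableSection` below the unit-clause threshold.** For every
`k ≥ 3`, `α > 0` with `α·(k² - k)·2M_k < 2^k` (`M_k = (k-2)^{k-2}/(k-1)^{k-1}`; equivalently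
`α < α_UC(k) = (2^{k-1}/k)((k-1)/(k-2))^{k-2}`, the Chao–Franco threshold), and all `η, ν, c > 0`: for
all large `n` (`m = ⌊α n⌋₊`) some map `g` (the localized unit-clause rule) is `νm`-valid at every splice
point of the Bresler–Huang path and `ηn`-stable between consecutive splice points on at least
`e^{-cn}·#paths` of the path tuples. -/
theorem sissU_conclusion_of_threshold (k : ℕ) (hk : 3 ≤ k) (α η ν : ℝ) (hα : 0 < α)
    (hαk : α * ((k * k - k : ℕ) : ℝ) * (2 * (((k : ℝ) - 2) ^ (k - 2) / ((k : ℝ) - 1) ^ (k - 1))) < (2 : ℝ) ^ k)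
    (hη : 0 < η) (hν : 0 < ν) (c : ℝ) (hc : 0 < c) :
    ∀ᶠ n : ℕ in atTop, ∀ m : ℕ, m = ⌊α * n⌋₊ →
      ∃ g : (Fin m → Fin k → Fin n × Bool) → (Fin n → Bool),
        Real.exp (-(c * n)) * Fintype.card (Fin (k + 1) → Fin m → Fin k → Fin n × Bool) ≤
        ((Finset.univ.filter fun Ψ : Fin (k + 1) → Fin m → Fin k → Fin n × Bool =>
          let P : Fin k → ℕ → Fin m → Fin k → Fin n × Bool :=
            fun r q a b => if (a : ℕ) * k + b < q then Ψ r.succ a b else Ψ r.castSucc a b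
          (∀ r : Fin k, ∀ q ≤ m * k, ((Finset.univ.filter fun i : Fin m =>
            ∀ j, g (P r q) (P r q i j).1 ≠ (P r q i j).2).card : ℝ) ≤ ν * m) ∧
          ∀ r : Fin k, ∀ q < m * k,
            (hammingDist (g (P r q)) (g (P r (q + 1))) : ℝ) ≤ η * n).card : ℝ) := by
  have hk1 : 1 ≤ k := le_trans (by norm_num) hk
  have hk2 : 2 ≤ k := le_trans (by norm_num) hk
  have hk3 : (3 : ℝ) ≤ k := by exact_mod_cast hk
  -- constants
  obtain ⟨Mk, hMk⟩ : ∃ Mk : ℝ, Mk = ((k : ℝ) - 2) ^ (k - 2) / ((k : ℝ) - 1) ^ (k - 1) := ⟨_, rfl⟩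
  have hMk0 : 0 < Mk := by
    have : (0 : ℝ) < (k : ℝ) - 1 := by linarith
    have : (0 : ℝ) < (k : ℝ) - 2 := by linarith
    rw [hMk]; positivity
  obtain ⟨K', hK'⟩ : ∃ K' : ℝ, K' = ((k * k - k : ℕ) : ℝ) * (2 * Mk) := ⟨_, rfl⟩
  have hK'0 : 0 ≤ K' := by rw [hK']; positivity
  obtain ⟨β, hβ⟩ : ∃ β : ℝ, β = α * K' / (2 : ℝ) ^ k := ⟨_, rfl⟩
  have hβ0 : 0 ≤ β := by rw [hβ]; positivity
  have hβ1 : β < 1 := by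
    rw [hβ, div_lt_one (by positivity), hK', ← mul_assoc, hMk]; exact hαk
  obtain ⟨K₂', hK₂'⟩ : ∃ K₂' : ℝ, K₂' = ((k * k * (k * k - k) * 2 : ℕ) : ℝ) := ⟨_, rfl⟩
  have hK₂'0 : 0 ≤ K₂' := by rw [hK₂']; exact Nat.cast_nonneg _
  obtain ⟨D₁, hD₁⟩ : ∃ D₁ : ℝ, D₁ = α ^ 2 * (K' * K₂' / ((2 : ℝ) ^ k) ^ 2) + α * ((k * k - k : ℕ) : ℝ) := ⟨_, rfl⟩
  have hD₁0 : 0 ≤ D₁ := by rw [hD₁]; positivity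
  obtain ⟨D₀, hD₀⟩ : ∃ D₀ : ℝ, D₀ = α * ((k * k - k : ℕ) : ℝ) := ⟨_, rfl⟩
  -- the number of rounds
  obtain ⟨R, hR1, hrate⟩ := sissU_rates β D₁ D₀ α ν hβ0 hβ1 hD₁0 hα hν
  have hRpos : (0 : ℝ) < R := by exact_mod_cast hR1
  -- the engine
  obtain ⟨μ, hμ⟩ : ∃ μ : ℝ, μ = ν / 2 := ⟨_, rfl⟩
  have hμν : μ < ν := by rw [hμ]; linarith
  refine sissMV_concl_of_localMean k R hk1 α η ν μ hα hη hμν ?_ c hc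
  filter_upwards [hrate, eventually_ge_atTop R, eventually_ge_atTop 1] with n hn hnR hn1 m hm
  have hnpos : (0 : ℝ) < n := by exact_mod_cast hn1
  have hm_le : (m : ℝ) ≤ α * n := by rw [hm]; exact Nat.floor_le (by positivity)
  have hm_ge : α * n - 1 ≤ (m : ℝ) := by
    rw [hm]; have := Nat.lt_floor_add_one (α * n); linarith
  have hC : (Fintype.card (Fin k → Fin n × Bool) : ℝ) = (2 * (n : ℝ)) ^ k := by
    rw [sissU_card_contents]; push_cast; ring
  have hCpos : (0 : ℝ) < (2 * (n : ℝ)) ^ k := by positivity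
  have hnk1 : (n : ℝ) ^ k = (n : ℝ) ^ (k - 1) * n := by
    rw [← pow_succ, Nat.sub_add_cancel hk1]
  -- the levels `W, a, q`
  obtain ⟨W, hW⟩ : ∃ W : ℝ, W = (n : ℝ) / R + 1 := ⟨_, rfl⟩
  have hW0 : 0 ≤ W := by rw [hW]; positivity
  have h1β : 0 < 1 - β := by linarith
  have h1β2 : 0 < 1 - β ^ 2 := by nlinarith
  obtain ⟨a, ha⟩ : ∃ a : ℝ, a = β * W / (1 - β) := ⟨_, rfl⟩
  have ha0 : 0 ≤ a := by rw [ha]; positivity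
  have haβ : a = β * (W + a) := by
    rw [ha]; field_simp; ring
  obtain ⟨q, hq⟩ : ∃ q : ℝ, q = (a + β ^ 2 * (W ^ 2 + 2 * W * a)) / (1 - β ^ 2) := ⟨_, rfl⟩
  have hq0 : 0 ≤ q := by rw [hq]; positivity
  have hqfix' : q = a + β ^ 2 * ((W ^ 2 + 2 * W * a) + q) := by
    rw [hq]; field_simp; ring
  have hQ0 : 0 ≤ W ^ 2 + 2 * W * a + q := by positivity
  -- `m·K'·n^{k-1} ≤ β·#C`
  have hmK : ((k * k - k : ℕ) : ℝ) * (2 * Mk * (n : ℝ) ^ (k - 1)) * (m : ℝ) ≤ β * (2 * (n : ℝ)) ^ k := by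
    have e : β * (2 * (n : ℝ)) ^ k = ((k * k - k : ℕ) : ℝ) * (2 * Mk * (n : ℝ) ^ (k - 1)) * (α * n) := by
      rw [hβ, div_mul_eq_mul_div, div_eq_iff (by positivity), hK', mul_pow, hnk1]; ring
    rw [e]
    exact mul_le_mul_of_nonneg_left hm_le (by positivity)
  -- the rate bound at this `n`
  have hrateQ : (R : ℝ) * (W ^ 2 + 2 * W * a + q) * D₁ / n + D₀ ≤ ν / 2 * (α * n - 1) := by
    rw [hq, ha, hW]; exact hn
  -- the objects
  obtain ⟨st, dm, h0, hstep, hdm⟩ := sissU_exists_dyn (m := m) (k := k) (n := n) R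
  refine ⟨fun Φ v => (st ∅ R Φ v).getD true, fun Φ Φ' v H => ?_, ?_⟩
  · -- locality
    show (st ∅ R Φ v).getD true = (st ∅ R Φ' v).getD true
    rw [sissU_local st dm h0 hstep hdm ∅ R Φ Φ' v H]
  -- the mean violation
  have hM := sissU_hM k hk n
  rw [← hMk] at hM
  have hWt : ∀ t : ℕ, ((((univ : Finset (Fin n)).filter fun v : Fin n => (v : ℕ) * R / n = t).card : ℕ) : ℝ) ≤ W := by
    intro t
    have h1 := sissU_card_window_le (n := n) hR1 t
    calc ((((univ : Finset (Fin n)).filter fun v : Fin n => (v : ℕ) * R / n = t).card : ℕ) : ℝ)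
        ≤ ((n / R + 1 : ℕ) : ℝ) := by exact_mod_cast h1
      _ ≤ W := by rw [hW]; push_cast; exact add_le_add Nat.cast_div_le le_rfl
  -- first moment
  have hfix : ((k * k - k : ℕ) : ℝ) * (2 * Mk * (n : ℝ) ^ (k - 1)) * (m : ℝ) * (W + a) ≤
      a * Fintype.card (Fin k → Fin n × Bool) := by
    rw [hC]
    calc ((k * k - k : ℕ) : ℝ) * (2 * Mk * (n : ℝ) ^ (k - 1)) * (m : ℝ) * (W + a)
        ≤ (β * (2 * (n : ℝ)) ^ k) * (W + a) := mul_le_mul_of_nonneg_right hmK (by positivity)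
      _ = (β * (W + a)) * (2 * (n : ℝ)) ^ k := by ring
      _ = a * (2 * (n : ℝ)) ^ k := by rw [← haβ]
  have hN := sissU_sum_unit_le st dm h0 hstep hdm hk2 hn1 Mk hM W hWt a ha0 hfix
  -- second moment
  have hqfix : (Fintype.card (Fin k → Fin n × Bool) : ℝ) ^ 2 * a +
      ((m : ℝ) * m) * (((k * k - k : ℕ) : ℝ) * (2 * Mk * (n : ℝ) ^ (k - 1))) ^ 2 * (W ^ 2 + 2 * W * a + q)
        ≤ q * (Fintype.card (Fin k → Fin n × Bool) : ℝ) ^ 2 := by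
    rw [hC]
    have h0' : 0 ≤ ((k * k - k : ℕ) : ℝ) * (2 * Mk * (n : ℝ) ^ (k - 1)) * (m : ℝ) := by positivity
    have hsq' := pow_le_pow_left₀ h0' hmK 2
    have hsq : ((m : ℝ) * m) * (((k * k - k : ℕ) : ℝ) * (2 * Mk * (n : ℝ) ^ (k - 1))) ^ 2 ≤
        (β * (2 * (n : ℝ)) ^ k) ^ 2 := by
      calc ((m : ℝ) * m) * (((k * k - k : ℕ) : ℝ) * (2 * Mk * (n : ℝ) ^ (k - 1))) ^ 2
          = (((k * k - k : ℕ) : ℝ) * (2 * Mk * (n : ℝ) ^ (k - 1)) * (m : ℝ)) ^ 2 := by ring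
        _ ≤ _ := hsq'
    calc ((2 * (n : ℝ)) ^ k) ^ 2 * a +
          ((m : ℝ) * m) * (((k * k - k : ℕ) : ℝ) * (2 * Mk * (n : ℝ) ^ (k - 1))) ^ 2 * (W ^ 2 + 2 * W * a + q)
        ≤ ((2 * (n : ℝ)) ^ k) ^ 2 * a + (β * (2 * (n : ℝ)) ^ k) ^ 2 * (W ^ 2 + 2 * W * a + q) :=
          add_le_add le_rfl (mul_le_mul_of_nonneg_right hsq hQ0)
      _ = (a + β ^ 2 * ((W ^ 2 + 2 * W * a) + q)) * ((2 * (n : ℝ)) ^ k) ^ 2 := by ring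
      _ = q * ((2 * (n : ℝ)) ^ k) ^ 2 := by rw [← hqfix']
  have hSq := sissU_sum_unit_sq_le st dm h0 hstep hdm Mk hM W hWt a hN hk2 hn1 q hq0 hqfix
  -- the mean bound and the rates
  have hmean := sissU_sum_violated_le st dm h0 hstep hdm hk2 hn1 hR1 Mk hM W hWt a ha0 hN q hq0 hSq
  refine hmean.trans (mul_le_mul_of_nonneg_right ?_ (Nat.cast_nonneg _))
  rw [hC]
  have hterms := sissU_terms_le k hk n m R hn1 α (((k * k - k : ℕ) : ℝ) * (2 * Mk)) K₂'
    (W ^ 2 + 2 * W * a + q) hα.le (by positivity) hK₂'0 hQ0 hm_le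
  have hshape : (R : ℝ) * (((m : ℝ) * m) * (((((k * k - k : ℕ) : ℝ) * (2 * Mk)) * (n : ℝ) ^ (k - 1)) *
      (K₂' * (n : ℝ) ^ (k - 2))) * (W ^ 2 + 2 * W * a + q)) / ((2 * (n : ℝ)) ^ k) ^ 2
      = (R : ℝ) * (((m : ℝ) * m) * ((((k * k - k : ℕ) : ℝ) * (2 * Mk * (n : ℝ) ^ (k - 1))) *
          ((k * k * (k * k - k) * 2 : ℕ) * (n : ℝ) ^ (k - 2))) * (W ^ 2 + 2 * W * a + q)) / ((2 * (n : ℝ)) ^ k) ^ 2 := by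
    rw [hK₂']; ring
  rw [hshape] at hterms
  refine hterms.trans ?_
  rw [← hK', ← hD₁, ← hD₀]
  refine hrateQ.trans ?_
  rw [hμ]
  exact mul_le_mul_of_nonneg_left hm_ge (by positivity)

/-- **Child G of line `RegimeSplit` (`stub_lowDensity`), verbatim.** For every `k ≥ 3`, every
`0 < α < 2^k/k` and all `η, ν, c > 0`: for all large `n` some map `g` is `νm`-valid at every splice
point of the Bresler–Huang path and `ηn`-stable between consecutive splice points on `≥ e^{-cn}·#paths`
(`α < 2^k/k` is below the unit-clause threshold since `((k-1)/(k-2))^{k-2} ≥ 2`). -/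
theorem sissU_lowDensity :
    ∀ k : ℕ, 3 ≤ k → ∀ α η ν : ℝ, 0 < α → α < 2 ^ k / k → 0 < η → 0 < ν → ∀ c : ℝ, 0 < c →
      ∀ᶠ n : ℕ in Filter.atTop, ∀ m : ℕ, m = ⌊α * n⌋₊ →
        ∃ g : (Fin m → Fin k → Fin n × Bool) → (Fin n → Bool),
          Real.exp (-(c * n)) * Fintype.card (Fin (k + 1) → Fin m → Fin k → Fin n × Bool) ≤
          ((Finset.univ.filter fun Ψ : Fin (k + 1) → Fin m → Fin k → Fin n × Bool =>
            let P : Fin k → ℕ → Fin m → Fin k → Fin n × Bool :=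
              fun r q a b => if (a : ℕ) * k + b < q then Ψ r.succ a b else Ψ r.castSucc a b
            (∀ r : Fin k, ∀ q ≤ m * k, ((Finset.univ.filter fun i : Fin m =>
              ∀ j, g (P r q) (P r q i j).1 ≠ (P r q i j).2).card : ℝ) ≤ ν * m) ∧
            ∀ r : Fin k, ∀ q < m * k,
              (hammingDist (g (P r q)) (g (P r (q + 1))) : ℝ) ≤ η * n).card : ℝ) := by
  intro k hk α η ν hα hαk hη hν c hc
  exact sissU_conclusion_of_threshold k hk α η ν hα (sissU_threshold_of_density_lt k hk α hα hαk) hη hν c hc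


/-- **The registered stub `stub_lowDensity` of line `RegimeSplit` (child G), landed** — the same
statement as `sissU_lowDensity`, under the stub's registered name. -/
theorem stub_lowDensity :
    ∀ k : ℕ, 3 ≤ k → ∀ α η ν : ℝ, 0 < α → α < 2 ^ k / k → 0 < η → 0 < ν → ∀ c : ℝ, 0 < c →
      ∀ᶠ n : ℕ in Filter.atTop, ∀ m : ℕ, m = ⌊α * n⌋₊ →
        ∃ g : (Fin m → Fin k → Fin n × Bool) → (Fin n → Bool),
          Real.exp (-(c * n)) * Fintype.card (Fin (k + 1) → Fin m → Fin k → Fin n × Bool) ≤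
          ((Finset.univ.filter fun Ψ : Fin (k + 1) → Fin m → Fin k → Fin n × Bool =>
            let P : Fin k → ℕ → Fin m → Fin k → Fin n × Bool :=
              fun r q a b => if (a : ℕ) * k + b < q then Ψ r.succ a b else Ψ r.castSucc a b
            (∀ r : Fin k, ∀ q ≤ m * k, ((Finset.univ.filter fun i : Fin m =>
              ∀ j, g (P r q) (P r q i j).1 ≠ (P r q i j).2).card : ℝ) ≤ ν * m) ∧
            ∀ r : Fin k, ∀ q < m * k,
              (hammingDist (g (P r q)) (g (P r (q + 1))) : ℝ) ≤ η * n).card : ℝ) :=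
  sissU_lowDensity

/-- **The crux from children M and T alone.** With child G proved (`sissU_lowDensity`), the crux
`SolvableImpliesStableSection` follows from `stub_midDensity` (f-free sections on
`2^k/k ≤ α < 2^k log k/k`) and `stub_core` (the transfer on the core) by the split glue
`sissS_solvableImpliesStableSection_of_split`. -/
theorem sissU_solvableImpliesStableSection_of_mid_core
    (hM : ∀ k : ℕ, 3 ≤ k → ∀ α η ν : ℝ, 2 ^ k / k ≤ α → α < 2 ^ k * Real.log k / k → 0 < η → 0 < ν →
      ∀ c : ℝ, 0 < c → ∀ᶠ n : ℕ in Filter.atTop, ∀ m : ℕ, m = ⌊α * n⌋₊ →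
        ∃ g : (Fin m → Fin k → Fin n × Bool) → (Fin n → Bool),
          Real.exp (-(c * n)) * Fintype.card (Fin (k + 1) → Fin m → Fin k → Fin n × Bool) ≤
          ((Finset.univ.filter fun Ψ : Fin (k + 1) → Fin m → Fin k → Fin n × Bool =>
            let P : Fin k → ℕ → Fin m → Fin k → Fin n × Bool :=
              fun r q a b => if (a : ℕ) * k + b < q then Ψ r.succ a b else Ψ r.castSucc a b
            (∀ r : Fin k, ∀ q ≤ m * k, ((Finset.univ.filter fun i : Fin m =>
              ∀ j, g (P r q) (P r q i j).1 ≠ (P r q i j).2).card : ℝ) ≤ ν * m) ∧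
            ∀ r : Fin k, ∀ q < m * k,
              (hammingDist (g (P r q)) (g (P r (q + 1))) : ℝ) ≤ η * n).card : ℝ))
    (hT : ∀ k : ℕ, 3 ≤ k → ∀ α η ν : ℝ, 2 ^ k * Real.log k / k ≤ α → α < 2 ^ k * Real.log 2 →
      0 < η → η < 1 → 0 < ν → ν ≤ (1 / 2 : ℝ) ^ k →
      (∃ f : List Bool → List Bool, Literature.Computability.Complexity.IsPolyTime f ∧
        ∃ ε : ℝ, 0 < ε ∧ ∃ᶠ n : ℕ in Filter.atTop, ∀ m : ℕ, m = ⌊α * n⌋₊ → ε ≤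
          ((Finset.univ.filter fun Φ : Fin m → Fin k → Fin n × Bool => ∀ i, ∃ j,
            (f (Literature.Computability.Complexity.encodingCNF.encode (List.ofFn fun a =>
              List.ofFn fun b => (((Φ a b).1 : ℕ), (Φ a b).2)))).getD (Φ i j).1 false =
                (Φ i j).2).card : ℝ) / Fintype.card (Fin m → Fin k → Fin n × Bool)) →
      ∀ c : ℝ, 0 < c → ∃ᶠ n : ℕ in Filter.atTop, ∀ m : ℕ, m = ⌊α * n⌋₊ →
        ∃ g : (Fin m → Fin k → Fin n × Bool) → (Fin n → Bool),
          Real.exp (-(c * n)) * Fintype.card (Fin (k + 1) → Fin m → Fin k → Fin n × Bool) ≤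
          ((Finset.univ.filter fun Ψ : Fin (k + 1) → Fin m → Fin k → Fin n × Bool =>
            let P : Fin k → ℕ → Fin m → Fin k → Fin n × Bool :=
              fun r q a b => if (a : ℕ) * k + b < q then Ψ r.succ a b else Ψ r.castSucc a b
            (∀ r : Fin k, ∀ q ≤ m * k, ((Finset.univ.filter fun i : Fin m =>
              ∀ j, g (P r q) (P r q i j).1 ≠ (P r q i j).2).card : ℝ) ≤ ν * m) ∧
            ∀ r : Fin k, ∀ q < m * k,
              (hammingDist (g (P r q)) (g (P r (q + 1))) : ℝ) ≤ η * n).card : ℝ)) :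
    Summit.PneNP.PneNP.Theses.OverlapGapAlgebra.SolvableImpliesStableSection :=
  sissS_solvableImpliesStableSection_of_split sissU_lowDensity hM hT

end Assembly

end Summit.PneNP.PneNP.Theorems
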